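import Literature.MathematicalPhysics.QuantumFieldTheory.Balaban1983to89.B9SmoothHolderClassState
import Literature.MathematicalPhysics.QuantumFieldTheory.Balaban1983to89.B9Thm312WholeStepRegular

/-!
# `Balaban1983to89.B9SmoothHolderClassStateDominated` — the regular state class `𝔖₂ = (Lʲη)⁻¹·bHZKPG g w` IS DOMINATED BY THE GLOBAL ℓ¹ SIZE on the finite carrier, hence
# every operator out of a sharp state norm has an a-priori CONSTANT majorant into it — the `hap` of `B9Thm312WholeStepRegular.hasMaj_right_of_stepS` (finite-dimensional
# bookkeeping behind [4] (2.66), no estimate of the papers)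

T. Bałaban, *Propagators for lattice gauge theories in a background field*, Commun. Math. Phys. **99** (1985) 389–434 [`Balaban1985BackgroundPropagators`,
"B9"]; [4] = T. Bałaban, *Propagators and renormalization transformations for lattice gauge theories. II*, Commun. Math. Phys. **96** (1984) 223–250
[`Balaban1984PropagatorsII`].  statement-level skeleton of published theorems with citation tags; proofs where landed; nothing here is a claim about the
Yang–Mills mass gap.  Sequel of `B9SmoothHolderClassState` (dag-n06-l g26) and `B9Thm312WholeStepRegular` (`exists_hasMaj_const_of_dom`).

THE POINT (dag-n06-l LOCATED-U8, `DELTA2-LETTERS-MEMO.md` §6).  The resolvent bootstrap over the regular state (`hasMaj_right_of_stepS`) needs an A-PRIORI constant majorant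
`hap` of `A∘F` INTO the state class; `exists_hasMaj_const_of_dom` reduces it to a domination `loc y F ≤ Λ·Σ_x |F x|`.  THIS FILE proves that domination for the (P1′) class
and its dimension-2 carry: `bHZKPG`'s size is below its `s = 1` envelope (`graded_loc_le_dom`), whose two channels — a sup over finitely many bonds and a weighted transported
pair difference over finitely many pairs (`trDif`: coordinates of `Ψ(x) − R(g)Ψ(x′)`, `R(g)X = gXg⁻¹`) — are each below a constant times the global ℓ¹ size; every
constant (pair weights, `‖g‖‖g⁻¹‖`, scale weights) is bounded by finiteness of the carrier (`Finite.exists_le`), no unitarity used.  ★ `bHZKPG_loc_le_dom`, `abs_trDif_le_sum`,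
★★ `exists_state_loc_le_sum` (`∃ Λ ≥ 0, ∀ y F, 𝔖₂.loc y F ≤ Λ·Σ|F|`), ★★ `exists_hasMaj_const_state` (the `hap`: `∃ M₀ ≥ 0, HasMaj (cNorm blkV q) 𝔖₂ T (fun _ _ => M₀)` for EVERY `T`).
HONEST SCOPE.  Finite-dimensional bookkeeping; nothing of [B9]∕[4] asserted; no pin, no certificate edit; COUNT-NEUTRAL; N06 NOT discharged; nothing continuum ∕ OS ∕ mass gap.
Cell `pub-ymgap` (HUMAN RULING D-0062), Track A node N06 [B9], bundle F7 rows 20–21, seat `pub-ymgap-dag-n06-l` (g26), 2026-08-29.  NEW file; nothing landed is modified.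
-/

noncomputable section

namespace Literature.MathematicalPhysics.QuantumFieldTheory.Balaban1983to89.B9SmoothHolderClassStateDominated

open B6KLevelCensusIndexV1 (KIdx)
open B9GeoNormsKLevelV1 (geo9K)
open B9Thm34Ext (toB6)
open B9SectDSup (weightNorm weightNorm_loc)
open B11SectG (BlockNorm HasMaj)
open B11SectGGlobal (Size)
open B11SectGGlobalSizes
open B11SectGSmoothCutT (ofPairsT_sz_le)
open B11SectGGradedClass (graded_loc_le_dom)
open B9Thm312Whole (GeoOK cNorm)
open B9Thm312WholeClasses (rwt rwt_nonneg)
open B9Thm39ReadingCoords (coordBound39 basisBound39 abs_repr_le)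
open B9CoReadingCoords (XBK assembleK)
open B9SmoothHolderClassS (Wscl Wscl_nonneg)
open B9SmoothHolderClassK (srcY NearPairK wEtaK wEtaK_nonneg)
open B9SmoothHolderClassT (trDif trDif_apply bHZKT bHZKT_loc)
open B9SmoothHolderClassP (bHZKPG)
open B9MultiscaleSmoothPartitionY (NearY)
open B9GradViaDivLettersAtPinsHolderPairs (norm_assembleK_le)
open B9Eq39Adjoint (R R_def)
open B9Thm312WholeStepRegular (exists_hasMaj_const_of_dom)
open Node00 (FBondY IBondY)

variable {d ℓ : ℕ} {hd : 1 ≤ d + 1} {hL : Odd (ℓ + 1) ∧ 1 < ℓ + 1} {b₀ b₁ : ℝ}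
variable {𝔸 : Type} [NormedRing 𝔸] [NormedAlgebra ℂ 𝔸] [CompleteSpace 𝔸] [FiniteDimensional ℝ 𝔸]
variable {κ : Type} [Fintype κ]
variable (i : KIdx d ℓ hd hL b₀ b₁) [Fintype (geo9K i).Site] (b : Module.Basis κ ℝ 𝔸) (g : FBondY i → FBondY i → 𝔸ˣ) {R₀ : ℝ} {H₀ : Prop}
variable (w : ℝ → ℝ) (hw0 : ∀ s, 0 ≤ w s) (hw1 : ∀ s, w s ≤ 1)

omit [CompleteSpace 𝔸] [FiniteDimensional ℝ 𝔸] in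
/-- ★ the graded print-weighted bond class is dominated by its `s = 1` envelope `Wscl 1·(bHZKT g 1 1).loc` (the domination built into `BlockNorm.graded`).
[cite: Balaban1984PropagatorsII, (2.1) p.224 («Lʲη ≦ 1»), bookkeeping; Balaban1985BackgroundPropagators, (3.43) p.398] -/
theorem bHZKPG_loc_le_dom (y : IBondY i) (F : XBK κ i → ℝ) :
    (bHZKPG (κ := κ) i b g (R := R₀) (H := H₀) w hw0 hw1).loc y F ≤
      Wscl i 1 y * (bHZKT (κ := κ) i b g (R := R₀) (H := H₀) (ε := 1) (p := 1) zero_le_one le_rfl le_rfl).loc y F := by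
  unfold bHZKPG
  exact graded_loc_le_dom (mul_nonneg (Wscl_nonneg i 1 y) (BlockNorm.loc_nonneg _ _ _))

omit [Fintype (geo9K i).Site] [CompleteSpace 𝔸] in
/-- the transported pair difference is below `coordBound·(1 + ‖g‖‖g⁻¹‖)·basisBound·Σ_x|F x|` (`R(g)X = gXg⁻¹`). [cite: Balaban1985BackgroundPropagators, (3.40) p.397, bookkeeping] -/
theorem abs_trDif_le_sum (q q' : XBK κ i) (F : XBK κ i → ℝ) :
    |trDif b g q q' F| ≤ coordBound39 b * ((1 + ‖((g q.1 q'.1 : 𝔸ˣ) : 𝔸)‖ * ‖(((g q.1 q'.1)⁻¹ : 𝔸ˣ) : 𝔸)‖) * (basisBound39 b * ∑ x : XBK κ i, |F x|)) := by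
  classical
  have hS : ∀ z : FBondY i, ∑ a : κ, |F (z, q.2.1, a, q.2.2.2)| ≤ ∑ x : XBK κ i, |F x| := by
    intro z
    have hinj : Function.Injective (fun a : κ => ((z, q.2.1, a, q.2.2.2) : XBK κ i)) := by
      intro a a' h
      simpa using h
    calc ∑ a : κ, |F (z, q.2.1, a, q.2.2.2)| = ∑ x ∈ Finset.univ.image (fun a : κ => ((z, q.2.1, a, q.2.2.2) : XBK κ i)), |F x| := by
          rw [Finset.sum_image fun a _ a' _ h => hinj h]
      _ ≤ ∑ x : XBK κ i, |F x| := Finset.sum_le_sum_of_subset_of_nonneg (Finset.subset_univ _) fun _ _ _ => abs_nonneg _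
  have hbB : 0 ≤ basisBound39 b := Finset.sum_nonneg fun _ _ => norm_nonneg _
  have hA : ∀ z : FBondY i, ‖assembleK b q.2.1 q.2.2.2 F z‖ ≤ basisBound39 b * ∑ x : XBK κ i, |F x| := fun z =>
    (norm_assembleK_le b q.2.1 q.2.2.2 F z).trans (mul_le_mul_of_nonneg_left (hS z) hbB)
  set S : ℝ := basisBound39 b * ∑ x : XBK κ i, |F x| with hSdef
  have hS0 : 0 ≤ S := mul_nonneg hbB (Finset.sum_nonneg fun _ _ => abs_nonneg _)
  rw [trDif_apply]
  refine (abs_repr_le b _ _).trans (mul_le_mul_of_nonneg_left ?_ (norm_nonneg _))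
  have hR : ‖R (g q.1 q'.1) (assembleK b q.2.1 q.2.2.2 F q'.1)‖ ≤ ‖((g q.1 q'.1 : 𝔸ˣ) : 𝔸)‖ * ‖(((g q.1 q'.1)⁻¹ : 𝔸ˣ) : 𝔸)‖ * S := by
    rw [R_def]
    calc ‖((g q.1 q'.1 : 𝔸ˣ) : 𝔸) * assembleK b q.2.1 q.2.2.2 F q'.1 * (((g q.1 q'.1)⁻¹ : 𝔸ˣ) : 𝔸)‖
        ≤ ‖((g q.1 q'.1 : 𝔸ˣ) : 𝔸)‖ * ‖assembleK b q.2.1 q.2.2.2 F q'.1‖ * ‖(((g q.1 q'.1)⁻¹ : 𝔸ˣ) : 𝔸)‖ :=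
          (norm_mul_le _ _).trans (mul_le_mul_of_nonneg_right (norm_mul_le _ _) (norm_nonneg _))
      _ ≤ ‖((g q.1 q'.1 : 𝔸ˣ) : 𝔸)‖ * S * ‖(((g q.1 q'.1)⁻¹ : 𝔸ˣ) : 𝔸)‖ :=
          mul_le_mul_of_nonneg_right (mul_le_mul_of_nonneg_left (hA q'.1) (norm_nonneg _)) (norm_nonneg _)
      _ = _ := by ring
  calc ‖assembleK b q.2.1 q.2.2.2 F q.1 - R (g q.1 q'.1) (assembleK b q.2.1 q.2.2.2 F q'.1)‖
      ≤ ‖assembleK b q.2.1 q.2.2.2 F q.1‖ + ‖R (g q.1 q'.1) (assembleK b q.2.1 q.2.2.2 F q'.1)‖ := norm_sub_le _ _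
    _ ≤ S + ‖((g q.1 q'.1 : 𝔸ˣ) : 𝔸)‖ * ‖(((g q.1 q'.1)⁻¹ : 𝔸ˣ) : 𝔸)‖ * S := add_le_add (hA q.1) hR
    _ = (1 + ‖((g q.1 q'.1 : 𝔸ˣ) : 𝔸)‖ * ‖(((g q.1 q'.1)⁻¹ : 𝔸ˣ) : 𝔸)‖) * S := by ring

omit [CompleteSpace 𝔸] in
/-- ★★ **THE STATE CLASS IS DOMINATED BY THE GLOBAL ℓ¹ SIZE**: `∃ Λ ≥ 0, ∀ y F, ((Lʲη)⁻¹·bHZKPG g w).loc y F ≤ Λ·Σ_x |F x|` — by finiteness of the carrier (bounded pair weights,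
bounded `‖g‖‖g⁻¹‖`, bounded scale weights); the `hdom` input of `B9Thm312WholeStepRegular.exists_hasMaj_const_of_dom`. [cite: Balaban1984PropagatorsII, (2.66) p.234, bookkeeping] -/
theorem exists_state_loc_le_sum (hG : GeoOK (geo9K i)) :
    ∃ Λ : ℝ, 0 ≤ Λ ∧ ∀ (y : IBondY i) (F : XBK κ i → ℝ),
      (weightNorm (bHZKPG (κ := κ) i b g (R := R₀) (H := H₀) w hw0 hw1) (rwt (geo9K i) (-1)) (rwt_nonneg hG.lenle (-1))).loc y F ≤
        Λ * ∑ x : XBK κ i, |F x| := by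
  classical
  -- bounded pair weights and transporter norms on the finite carrier
  obtain ⟨W₁, hW₁⟩ := Finite.exists_le (fun p : XBK κ i × XBK κ i => wEtaK i 1 p.1 p.2)
  obtain ⟨Cg, hCg⟩ := Finite.exists_le (fun p : XBK κ i × XBK κ i => ‖((g p.1.1 p.2.1 : 𝔸ˣ) : 𝔸)‖ * ‖(((g p.1.1 p.2.1)⁻¹ : 𝔸ˣ) : 𝔸)‖)
  set W : ℝ := max W₁ 0 with hWdef
  set C : ℝ := max Cg 0 with hCdef
  have hW0 : 0 ≤ W := le_max_right _ _
  have hC0 : 0 ≤ C := le_max_right _ _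
  have hcB : 0 ≤ coordBound39 b := norm_nonneg _
  have hbB : 0 ≤ basisBound39 b := Finset.sum_nonneg fun _ _ => norm_nonneg _
  -- the per-block constant and its bound over the finite site set
  set K : ℝ := W * (coordBound39 b * ((1 + C) * basisBound39 b)) with hKdef
  have hK0 : 0 ≤ K := by positivity
  obtain ⟨Λ₁, hΛ₁⟩ := Finite.exists_le (fun y : IBondY i => rwt (geo9K i) (-1) y * (Wscl i 1 y * (Wscl i 1 y + K)))
  refine ⟨max Λ₁ 0, le_max_right _ _, fun y F => ?_⟩
  set S : ℝ := ∑ x : XBK κ i, |F x| with hSdef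
  have hS0 : 0 ≤ S := Finset.sum_nonneg fun _ _ => abs_nonneg _
  -- the sup channel
  have hsup : (Size.ofSup (toB6 (geo9K i) R₀ H₀) (fun (q : XBK κ i) (y : IBondY i) => NearY i y (srcY i q))).sz y F ≤ S :=
    ofSup_sz_le _ hS0 fun x _ => Finset.single_le_sum (fun z _ => abs_nonneg (F z)) (Finset.mem_univ x)
  -- the pair channel
  have hpair : (B11SectGSmoothCutT.Size.ofPairsT (toB6 (geo9K i) R₀ H₀) (fun (q : XBK κ i) (y : IBondY i) => NearY i y (srcY i q)) (NearPairK i) (wEtaK i 1)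
      (wEtaK_nonneg i 1) (trDif b g)).sz y F ≤ K * S := by
    refine ofPairsT_sz_le _ _ _ _ _ (mul_nonneg hK0 hS0) fun z z' _ _ => ?_
    have h1 : wEtaK i 1 z z' ≤ W := (hW₁ (z, z')).trans (le_max_left _ _)
    have h2 : ‖((g z.1 z'.1 : 𝔸ˣ) : 𝔸)‖ * ‖(((g z.1 z'.1)⁻¹ : 𝔸ˣ) : 𝔸)‖ ≤ C := (hCg (z, z')).trans (le_max_left _ _)
    have h3 := abs_trDif_le_sum i b g z z' F
    have h4 : coordBound39 b * ((1 + ‖((g z.1 z'.1 : 𝔸ˣ) : 𝔸)‖ * ‖(((g z.1 z'.1)⁻¹ : 𝔸ˣ) : 𝔸)‖) * (basisBound39 b * S)) ≤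
        coordBound39 b * ((1 + C) * (basisBound39 b * S)) :=
      mul_le_mul_of_nonneg_left (mul_le_mul_of_nonneg_right (by linarith) (mul_nonneg hbB hS0)) hcB
    calc wEtaK i 1 z z' * |trDif b g z z' F| ≤ W * (coordBound39 b * ((1 + C) * (basisBound39 b * S))) :=
          mul_le_mul h1 (h3.trans h4) (abs_nonneg _) hW0
      _ = K * S := by rw [hKdef]; ring
  -- assemble
  have hT : (bHZKT (κ := κ) i b g (R := R₀) (H := H₀) (ε := 1) (p := 1) zero_le_one le_rfl le_rfl).loc y F ≤ (Wscl i 1 y + K) * S := by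
    rw [bHZKT_loc]
    calc Wscl i 1 y * _ + _ ≤ Wscl i 1 y * S + K * S := add_le_add (mul_le_mul_of_nonneg_left hsup (Wscl_nonneg i 1 y)) hpair
      _ = (Wscl i 1 y + K) * S := by ring
  have hP := (bHZKPG_loc_le_dom i b g (R₀ := R₀) (H₀ := H₀) w hw0 hw1 y F).trans (mul_le_mul_of_nonneg_left hT (Wscl_nonneg i 1 y))
  rw [weightNorm_loc]
  have hr0 : 0 ≤ rwt (geo9K i) (-1) y := rwt_nonneg hG.lenle (-1) y
  calc rwt (geo9K i) (-1) y * (bHZKPG (κ := κ) i b g (R := R₀) (H := H₀) w hw0 hw1).loc y F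
      ≤ rwt (geo9K i) (-1) y * (Wscl i 1 y * ((Wscl i 1 y + K) * S)) := mul_le_mul_of_nonneg_left hP hr0
    _ = (rwt (geo9K i) (-1) y * (Wscl i 1 y * (Wscl i 1 y + K))) * S := by ring
    _ ≤ max Λ₁ 0 * S := mul_le_mul_of_nonneg_right ((hΛ₁ y).trans (le_max_left _ _)) hS0

omit [CompleteSpace 𝔸] in
/-- ★★ **THE A-PRIORI MAJORANT INTO THE STATE CLASS** (the `hap` of `hasMaj_right_of_stepS`): for EVERY operator `T` out of a sharp state norm `𝔠_V^{(q)}` there is a constant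
`M₀ ≥ 0` with `HasMaj (cNorm blkV q) ((Lʲη)⁻¹·bHZKPG g w) T (fun _ _ => M₀)`. [cite: Balaban1984PropagatorsII, (2.66) p.234, bookkeeping; Balaban1985BackgroundPropagators, Thm 3.12 p.423] -/
theorem exists_hasMaj_const_state (hG : GeoOK (geo9K i)) {V : Type} [Fintype V] (blkV : V → IBondY i) (blk : XBK κ i → IBondY i) (q : ℕ)
    (T : (V → ℝ) →ₗ[ℝ] (XBK κ i → ℝ)) :
    ∃ M₀ : ℝ, 0 ≤ M₀ ∧ HasMaj (cNorm R₀ H₀ blkV hG.lenle q)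
      (weightNorm (bHZKPG (κ := κ) i b g (R := R₀) (H := H₀) w hw0 hw1) (rwt (geo9K i) (-1)) (rwt_nonneg hG.lenle (-1))) T (fun _ _ => M₀) := by
  obtain ⟨Λ, hΛ, hdom⟩ := exists_state_loc_le_sum i b g (R₀ := R₀) (H₀ := H₀) w hw0 hw1 hG
  exact exists_hasMaj_const_of_dom hG blkV blk q hΛ hdom T

end Literature.MathematicalPhysics.QuantumFieldTheory.Balaban1983to89.B9SmoothHolderClassStateDominated

end
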